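import Summits.BirchSwinnertonDyer.BirchSwinnertonDyer.Theorems.TwoAdicConverseTwoTorsionNFPointCountModFour
import Literature.NumberTheory.EllipticCurves.ComplexMultiplicationDeuringReduction
import Summits.BirchSwinnertonDyer.BirchSwinnertonDyer.Theorems.EisensteinDepletionAtTwoStarOptBNSFOddTransportArchAlgebra
import HarnessLib

/-!
# Route `TwoAdicConverse` (rung S3), crux `OrdLambdaHalfAtTwo` (item 19556): the mod-`4` trace at a prime where `Δ` is a SQUARE —
# `(Δ/ℓ) = 1 ⇒ a_ℓ` is odd or `a_ℓ ≡ ℓ + 1 (mod 4)` (no rational `2`-torsion needed; the cubic-image stratum (γ₁))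

Cell `bsd-2adic`, seat `bsd-2adic-conv-1` (GEN 21). THEOREMS ONLY — no named fact, no definition, nothing conditional. Companion of K0
(`TwoAdicConverseModFourTraceOneTwoTorsionPoint`, which needs a RATIONAL point of order `2`) for curves WITHOUT one — the irreducible
strata of line L2 `f4-semisimple-cubic-two` (C₃ image: `Δ ∈ ℚ×²`): at an odd good prime `ℓ` where the discriminant is a square, the
`2`-division cubic `ψ₂² = 4x³ + b₂x² + 2b₄x + b₆` has `0` or `3` roots in `𝔽_ℓ` (never exactly one: with a root `r`,
`disc(cofactor)·ψ₂²′(r)² = 16Δ` — the universal identity `sixteen_mul_Δ_eq_of_root_ring`, valid in any commutative ring — makes the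
cofactor split), so `Ẽ(𝔽_ℓ)[2]` is `0` or `(ℤ/2)²`, i.e. **`#Ẽ(𝔽_ℓ)` is odd or divisible by `4`**, i.e. **`a_ℓ` is odd or
`a_ℓ ≡ ℓ + 1 (mod 4)`; in particular `a_ℓ ≢ ℓ − 1 (mod 4)`** (K0's doubly-inert value `ε = −1` never occurs when `χ_Δ = 1`). On the
C₃ stratum this is the mod-`4` eigensystem «Eisenstein at the primes split in `K₃ = ℚ(E[2])`, odd trace at the inert ones».

* §1 `sixteen_mul_Δ_eq_of_root_ring` — the identity over any commutative ring (Mathlib's `b_relation` for `b₈`);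
* §2 (elliptic `V` over a field with `2 ≠ 0`): a root of `ψ₂²` is the abscissa of a point of order `2` and conversely
  (`exists_two_torsion_of_root`, `root_of_add_self_eq_zero`, via the tree's `ArchTransport.sq_eq_cubic_of_equation`); over a FINITE field: no root ⇒ `#V(𝔽)` odd (Cauchy), two roots ⇒
  `4 ∣ #V(𝔽)` (Klein, tree `four_dvd_natCard_of_two_torsion_pair`), a root and `Δ` a square ⇒ a second root ⇒
  **`four_dvd_or_odd_natCard_point_of_isSquare_Δ`**;
* §3 (transport to a globally minimal `W/ℚ`): `four_dvd_or_odd_reductionPointCount_of_isSquare`,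
  **`frobeniusTrace_of_isSquare_discr`** (`(Δ/ℓ) = 1 ⇒ Odd a_ℓ ∨ 4 ∣ ℓ + 1 − a_ℓ`), `not_four_dvd_pred_sub_frobeniusTrace_of_isSquare_discr`,
  and the global-square corollaries `…_of_isSquare_Δ` (`Δ_W ∈ ℚ×²`: C₃ image or full rational `2`-torsion).

HONEST FRAMING: elementary; nothing about `λ` or BSD; items 19556 / 19218 stay OPEN; BSD is not proved by any of this. PARTITION (D-0054):
none — RANK axis (S3). References: J. H. Silverman, *AEC* (2009), III.2.3 (`ψ₂`), V.2.3.1, VII.2 [SilvermanAEC2009]; A. W. Knapp,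
*Elliptic Curves* (1992), Thm. 4.2 [Knapp1993].
-/

set_option linter.dupNamespace false
set_option autoImplicit false

noncomputable section

open scoped Classical
open WeierstrassCurve Literature.NumberTheory.EllipticCurves

namespace Summit.BirchSwinnertonDyer.BirchSwinnertonDyer.Theorems.TwoAdicTwistConverse

/-! ## §1. The discriminant identity at a root of `ψ₂²`, over any commutative ring -/

/-- **`[(4r + b₂)² − 16(4r² + b₂r + 2b₄)]·(12r² + 2b₂r + 2b₄)² = 16Δ` whenever `4r³ + b₂r² + 2b₄r + b₆ = 0`**, for a Weierstrass
curve over ANY commutative ring (`ψ₂² = (x − r)(4x² + (4r + b₂)x + (4r² + b₂r + 2b₄))`; discriminant of the cofactor times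
`ψ₂²′(r)²`; exact modulo `ψ₂²(r)` with cofactor `−1728r³ − 432b₂r² − 864b₄r + 4b₂³ − 144b₂b₄ + 432b₆`). [folklore] -/
theorem sixteen_mul_Δ_eq_of_root_ring {R : Type*} [CommRing R] (V : WeierstrassCurve R) {r : R}
    (hr : 4 * r ^ 3 + V.b₂ * r ^ 2 + 2 * V.b₄ * r + V.b₆ = 0) :
    ((4 * r + V.b₂) ^ 2 - 16 * (4 * r ^ 2 + V.b₂ * r + 2 * V.b₄)) * (12 * r ^ 2 + 2 * V.b₂ * r + 2 * V.b₄) ^ 2 =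
      16 * V.Δ := by
  have hΔ : 16 * V.Δ = -4 * V.b₂ ^ 3 * V.b₆ + 4 * V.b₂ ^ 2 * V.b₄ ^ 2 - 128 * V.b₄ ^ 3 - 432 * V.b₆ ^ 2 +
      144 * V.b₂ * V.b₄ * V.b₆ := by
    simp only [WeierstrassCurve.Δ]
    linear_combination (-4 * V.b₂ ^ 2) * V.b_relation
  rw [hΔ]
  linear_combination (-1728 * r ^ 3 - 432 * V.b₂ * r ^ 2 - 864 * V.b₄ * r + (4 * V.b₂ ^ 3 - 144 * V.b₂ * V.b₄ + 432 * V.b₆)) * hr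

/-! ## §2. Roots of `ψ₂²` and points of order `2` on an elliptic curve over a field with `2 ≠ 0` -/

section Field

variable {F : Type*} [Field F] (V : WeierstrassCurve F) [V.IsElliptic]

/-- **A root of `ψ₂²` is the abscissa of a point of order `2`**: `P = (x, −(a₁x + a₃)/2)` is a nonsingular point with `P + P = O`.
[cite: SilvermanAEC2009, III.2.3] -/
theorem exists_two_torsion_of_root (h2 : (2 : F) ≠ 0) {x : F}
    (hx : 4 * x ^ 3 + V.b₂ * x ^ 2 + 2 * V.b₄ * x + V.b₆ = 0) :
    ∃ (y : F) (h : V.toAffine.Nonsingular x y), (Affine.Point.some x y h : V.toAffine.Point) + .some x y h = 0 := by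
  obtain ⟨y, h2y⟩ : ∃ y : F, 2 * y + V.a₁ * x + V.a₃ = 0 :=
    ⟨-(V.a₁ * x + V.a₃) / 2, by field_simp; ring⟩
  have h4 : (4 : F) ≠ 0 := by rw [show (4 : F) = 2 * 2 by norm_num]; exact mul_ne_zero h2 h2
  have heq : V.toAffine.Equation x y := by
    rw [Affine.equation_iff]
    simp only [WeierstrassCurve.toAffine_a₁, WeierstrassCurve.toAffine_a₂, WeierstrassCurve.toAffine_a₃,
      WeierstrassCurve.toAffine_a₄, WeierstrassCurve.toAffine_a₆]
    simp only [WeierstrassCurve.b₂, WeierstrassCurve.b₄, WeierstrassCurve.b₆] at hx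
    apply mul_left_cancel₀ h4
    linear_combination -hx + (2 * y + V.a₁ * x + V.a₃) * h2y
  have hns : V.toAffine.Nonsingular x y := (Affine.equation_iff_nonsingular).mp heq
  refine ⟨y, hns, Affine.Point.add_self_of_Y_eq ?_⟩
  rw [Affine.negY]
  simp only [WeierstrassCurve.toAffine_a₁, WeierstrassCurve.toAffine_a₃]
  linear_combination h2y

omit [V.IsElliptic] in
/-- **Conversely, an affine point of order `2` sits over a root of `ψ₂²`** (`P = −P` means `2y + a₁x + a₃ = 0`, and
`(2y + a₁x + a₃)² = ψ₂²(x)`). [cite: SilvermanAEC2009, III.2.3] -/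
theorem root_of_add_self_eq_zero {x y : F} (h : V.toAffine.Nonsingular x y)
    (hP : (Affine.Point.some x y h : V.toAffine.Point) + .some x y h = 0) :
    4 * x ^ 3 + V.b₂ * x ^ 2 + 2 * V.b₄ * x + V.b₆ = 0 := by
  have hy : y = V.toAffine.negY x y := by
    by_contra hne
    rw [Affine.Point.add_self_of_Y_ne hne] at hP
    exact Affine.Point.some_ne_zero _ hP
  rw [Affine.negY] at hy
  rw [← DepletionAtTwo.ArchTransport.sq_eq_cubic_of_equation V h.1]
  have : 2 * y + V.a₁ * x + V.a₃ = 0 := by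
    simp only [WeierstrassCurve.toAffine_a₁, WeierstrassCurve.toAffine_a₃] at hy
    linear_combination hy
  rw [this, zero_pow two_ne_zero]

/-- **Two distinct roots of `ψ₂²` give `4 ∣ #V(F)`** (two distinct points of order `2`; Klein four-group, Lagrange).
[cite: SilvermanAEC2009, III.2.3] -/
theorem four_dvd_natCard_point_of_two_roots (h2 : (2 : F) ≠ 0) {x₁ x₂ : F} (hx : x₁ ≠ x₂)
    (h₁ : 4 * x₁ ^ 3 + V.b₂ * x₁ ^ 2 + 2 * V.b₄ * x₁ + V.b₆ = 0)
    (h₂ : 4 * x₂ ^ 3 + V.b₂ * x₂ ^ 2 + 2 * V.b₄ * x₂ + V.b₆ = 0) : 4 ∣ Nat.card V.toAffine.Point := by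
  obtain ⟨y₁, hn₁, hP₁⟩ := exists_two_torsion_of_root V h2 h₁
  obtain ⟨y₂, hn₂, hP₂⟩ := exists_two_torsion_of_root V h2 h₂
  refine four_dvd_natCard_of_two_torsion_pair (a := Affine.Point.some x₁ y₁ hn₁) (b := Affine.Point.some x₂ y₂ hn₂)
    (Affine.Point.some_ne_zero _) (Affine.Point.some_ne_zero _) ?_ hP₁ hP₂
  intro h
  rw [Affine.Point.some.injEq] at h
  exact hx h.1

omit [V.IsElliptic] in
/-- **No root of `ψ₂²` ⇒ `#V(𝔽)` is odd** over a finite field: an element of order `2` (Cauchy) would be an affine point over a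
root. [cite: SilvermanAEC2009, III.2.3] -/
theorem not_two_dvd_natCard_point_of_no_root [Finite F]
    (hno : ∀ x : F, 4 * x ^ 3 + V.b₂ * x ^ 2 + 2 * V.b₄ * x + V.b₆ ≠ 0) : ¬ 2 ∣ Nat.card V.toAffine.Point := by
  haveI : Finite V.toAffine.Point := WeierstrassCurve.finite_point V
  haveI : Fact (Nat.Prime 2) := ⟨Nat.prime_two⟩
  intro h2
  obtain ⟨P, hP⟩ := exists_prime_addOrderOf_dvd_card' (G := V.toAffine.Point) 2 h2
  have hP2 : P + P = 0 := by rw [← two_nsmul, ← hP]; exact addOrderOf_nsmul_eq_zero P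
  have hP0 : P ≠ 0 := by
    intro h0
    rw [h0, addOrderOf_zero] at hP
    exact absurd hP (by norm_num)
  rcases P with _ | ⟨x, y, h⟩
  · exact hP0 rfl
  · exact hno x (root_of_add_self_eq_zero V h hP2)

/-- **A root of `ψ₂²` and `Δ` a square give a SECOND root** (`2 ≠ 0`): by `sixteen_mul_Δ_eq_of_root_ring` the cofactor
`4x² + (4r + b₂)x + (4r² + b₂r + 2b₄)` has the square discriminant `16Δ/ψ₂²′(r)²`, hence two roots, not both equal to `r`
(they differ, `Δ ≠ 0`). [folklore] -/
theorem exists_second_root_of_isSquare_Δ (h2 : (2 : F) ≠ 0) (hΔ : IsSquare V.Δ) {r : F}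
    (hr : 4 * r ^ 3 + V.b₂ * r ^ 2 + 2 * V.b₄ * r + V.b₆ = 0) :
    ∃ t : F, t ≠ r ∧ 4 * t ^ 3 + V.b₂ * t ^ 2 + 2 * V.b₄ * t + V.b₆ = 0 := by
  obtain ⟨w, hw⟩ := hΔ
  have hkey := sixteen_mul_Δ_eq_of_root_ring V hr
  have hΔ0 : V.Δ ≠ 0 := V.isUnit_Δ.ne_zero
  have h4 : (4 : F) ≠ 0 := by rw [show (4 : F) = 2 * 2 by norm_num]; exact mul_ne_zero h2 h2
  have h8 : (8 : F) ≠ 0 := by rw [show (8 : F) = 2 * 4 by norm_num]; exact mul_ne_zero h2 h4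
  have h16 : (16 : F) ≠ 0 := by rw [show (16 : F) = 4 * 4 by norm_num]; exact mul_ne_zero h4 h4
  have hG0 : 12 * r ^ 2 + 2 * V.b₂ * r + 2 * V.b₄ ≠ 0 := by
    intro h0
    rw [h0, zero_pow two_ne_zero, mul_zero] at hkey
    exact hΔ0 (by have := hkey; exact (mul_eq_zero.mp this.symm).resolve_left h16)
  -- square root of the cofactor's discriminant
  obtain ⟨sD, hsD⟩ : ∃ sD : F, sD ^ 2 = (4 * r + V.b₂) ^ 2 - 16 * (4 * r ^ 2 + V.b₂ * r + 2 * V.b₄) := by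
    refine ⟨4 * w / (12 * r ^ 2 + 2 * V.b₂ * r + 2 * V.b₄), ?_⟩
    rw [div_pow, div_eq_iff (pow_ne_zero _ hG0)]
    linear_combination -hkey - 16 * hw
  have hsD0 : sD ≠ 0 := by
    intro h0
    rw [h0, zero_pow two_ne_zero] at hsD
    have : ((4 * r + V.b₂) ^ 2 - 16 * (4 * r ^ 2 + V.b₂ * r + 2 * V.b₄)) = 0 := hsD.symm
    rw [this, zero_mul] at hkey
    exact hΔ0 ((mul_eq_zero.mp hkey.symm).resolve_left h16)
  -- the two roots `t±` (`8t± = −(4r + b₂) ± sD`) of the cofactor are roots of `ψ₂²`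
  have hb₆ : V.b₆ = -(4 * r ^ 3 + V.b₂ * r ^ 2 + 2 * V.b₄ * r) := by linear_combination hr
  have hfac : ∀ t : F, 4 * t ^ 3 + V.b₂ * t ^ 2 + 2 * V.b₄ * t + V.b₆ =
      (t - r) * (4 * t ^ 2 + (4 * r + V.b₂) * t + (4 * r ^ 2 + V.b₂ * r + 2 * V.b₄)) := by
    intro t; rw [hb₆]; ring
  have hroot : ∀ s t : F, s ^ 2 = (4 * r + V.b₂) ^ 2 - 16 * (4 * r ^ 2 + V.b₂ * r + 2 * V.b₄) →
      8 * t = -(4 * r + V.b₂) + s → 4 * t ^ 3 + V.b₂ * t ^ 2 + 2 * V.b₄ * t + V.b₆ = 0 := by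
    intro s t hs ht
    have hg : 4 * t ^ 2 + (4 * r + V.b₂) * t + (4 * r ^ 2 + V.b₂ * r + 2 * V.b₄) = 0 := by
      apply mul_left_cancel₀ h16
      linear_combination hs + (8 * t + (4 * r + V.b₂) + s) * ht
    rw [hfac, hg, mul_zero]
  obtain ⟨t₁, ht₁⟩ : ∃ t : F, 8 * t = -(4 * r + V.b₂) + sD := ⟨(-(4 * r + V.b₂) + sD) / 8, by field_simp⟩
  obtain ⟨t₂, ht₂⟩ : ∃ t : F, 8 * t = -(4 * r + V.b₂) + -sD := ⟨(-(4 * r + V.b₂) + -sD) / 8, by field_simp⟩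
  by_cases ht : t₁ = r
  · refine ⟨t₂, ?_, hroot (-sD) t₂ (by rw [neg_sq]; exact hsD) ht₂⟩
    intro ht'
    apply hsD0
    apply mul_left_cancel₀ h2
    rw [ht] at ht₁
    rw [ht'] at ht₂
    linear_combination ht₂ - ht₁
  · exact ⟨t₁, ht, hroot sD t₁ hsD ht₁⟩

/-- **`Δ` a square ⇒ `#V(𝔽)` is odd or divisible by `4`** for an elliptic curve over a finite field of odd characteristic:
`V(𝔽)[2]` is `0` (no root of `ψ₂²`) or `(ℤ/2)²` (a root, hence a second one). [cite: SilvermanAEC2009, III.2.3]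
[cite: Knapp1993, Thm. 4.2] -/
theorem four_dvd_or_odd_natCard_point_of_isSquare_Δ [Finite F] (h2 : (2 : F) ≠ 0) (hΔ : IsSquare V.Δ) :
    4 ∣ Nat.card V.toAffine.Point ∨ ¬ 2 ∣ Nat.card V.toAffine.Point := by
  by_cases hex : ∃ r : F, 4 * r ^ 3 + V.b₂ * r ^ 2 + 2 * V.b₄ * r + V.b₆ = 0
  · obtain ⟨r, hr⟩ := hex
    obtain ⟨t, htr, ht⟩ := exists_second_root_of_isSquare_Δ V h2 hΔ hr
    exact Or.inl (four_dvd_natCard_point_of_two_roots V h2 htr ht hr)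
  · push Not at hex
    exact Or.inr (not_two_dvd_natCard_point_of_no_root V hex)

end Field

/-! ## §3. Transport to a globally minimal curve over `ℚ` -/

section Rat

variable (W : WeierstrassCurve ℚ) [W.IsElliptic] [W.IsGloballyMinimal] (ℓ : ℕ) [Fact ℓ.Prime]

omit [W.IsElliptic] in
/-- **`(Δ/ℓ) = 1 ⇒ #W̃(𝔽_ℓ)` is odd or divisible by `4`** at an odd good prime `ℓ`. [cite: SilvermanAEC2009, III.2.3 and VII.2] -/
theorem four_dvd_or_odd_reductionPointCount_of_isSquare (hℓ : ℓ ≠ 2) (hgood : W.HasGoodReductionAtPrime ℓ)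
    (hΔ : IsSquare ((minimalDiscriminantInt W : ZMod ℓ))) :
    4 ∣ W.reductionPointCount ℓ ∨ ¬ 2 ∣ W.reductionPointCount ℓ := by
  have hΔℓ : ¬ (ℓ : ℤ) ∣ minimalDiscriminantInt W := not_dvd_minimalDiscriminantInt_of_hasGoodReductionAtPrime' W ℓ hgood
  haveI hE : (reductionModPrime W ℓ).IsElliptic := isElliptic_reductionModPrime W hΔℓ
  have h2F : (2 : ZMod ℓ) ≠ 0 := by
    intro h
    have h' : ((2 : ℕ) : ZMod ℓ) = 0 := by exact_mod_cast h
    rw [ZMod.natCast_eq_zero_iff] at h'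
    exact hℓ ((Nat.prime_dvd_prime_iff_eq Fact.out Nat.prime_two).mp h')
  have hΔV : IsSquare (reductionModPrime W ℓ).Δ := by
    simpa only [reductionModPrime, map_Δ, eq_intCast, minimalDiscriminantInt] using hΔ
  rw [reductionPointCount_eq_natCard_point]
  exact four_dvd_or_odd_natCard_point_of_isSquare_Δ (reductionModPrime W ℓ) h2F hΔV

omit [W.IsElliptic] in
/-- **`(Δ/ℓ) = 1 ⇒ a_ℓ` is odd or `a_ℓ ≡ ℓ + 1 (mod 4)`** at an odd good prime `ℓ` (`a_ℓ = ℓ + 1 − #W̃(𝔽_ℓ)`): the mod-`4` eigensystem at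
the primes split in `ℚ(√Δ)`, no rational `2`-torsion needed. [cite: SilvermanAEC2009, III.2.3 and V.2.3.1] -/
theorem frobeniusTrace_of_isSquare_discr (hℓ : ℓ ≠ 2) (hgood : W.HasGoodReductionAtPrime ℓ)
    (hΔ : IsSquare ((minimalDiscriminantInt W : ZMod ℓ))) :
    Odd (W.frobeniusTrace ℓ) ∨ (4 : ℤ) ∣ (ℓ : ℤ) + 1 - W.frobeniusTrace ℓ := by
  rw [WeierstrassCurve.frobeniusTrace]
  obtain ⟨k, hk⟩ := (Fact.out : ℓ.Prime).odd_of_ne_two hℓ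
  rcases four_dvd_or_odd_reductionPointCount_of_isSquare W ℓ hℓ hgood hΔ with h4 | hodd
  · right
    rw [sub_sub_cancel]
    exact_mod_cast h4
  · left
    have hN : Odd (W.reductionPointCount ℓ) := Nat.odd_iff.mpr (Nat.two_dvd_ne_zero.mp hodd)
    obtain ⟨j, hj⟩ := hN
    have hN' : (W.reductionPointCount ℓ : ℤ) = 2 * j + 1 := by exact_mod_cast hj
    have hℓ' : (ℓ : ℤ) = 2 * k + 1 := by exact_mod_cast hk
    refine ⟨(k : ℤ) - j, ?_⟩
    rw [hN', hℓ']
    ring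

omit [W.IsElliptic] in
/-- **`(Δ/ℓ) = 1 ⇒ a_ℓ ≢ ℓ − 1 (mod 4)`**: K0's doubly-inert value never occurs at a prime where `Δ` is a square.
[cite: SilvermanAEC2009, V.2.3.1] -/
theorem not_four_dvd_pred_sub_frobeniusTrace_of_isSquare_discr (hℓ : ℓ ≠ 2) (hgood : W.HasGoodReductionAtPrime ℓ)
    (hΔ : IsSquare ((minimalDiscriminantInt W : ZMod ℓ))) : ¬ (4 : ℤ) ∣ (ℓ : ℤ) - 1 - W.frobeniusTrace ℓ := by
  obtain ⟨k, hk⟩ := (Fact.out : ℓ.Prime).odd_of_ne_two hℓ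
  have hℓ' : (ℓ : ℤ) = 2 * k + 1 := by exact_mod_cast hk
  rintro ⟨j, hj⟩
  rcases frobeniusTrace_of_isSquare_discr W ℓ hℓ hgood hΔ with ⟨a, ha⟩ | ⟨i, hi⟩
  · omega
  · omega

omit [W.IsElliptic] in
/-- **Global square**: for `Δ_W ∈ ℚ×²` (cubic mod-`2` image `C₃`, or full rational `2`-torsion) and every odd good prime `ℓ`, `a_ℓ` is odd
or `a_ℓ ≡ ℓ + 1 (mod 4)`. [cite: SilvermanAEC2009, III.2.3 and V.2.3.1] -/
theorem frobeniusTrace_of_isSquare_Δ (hℓ : ℓ ≠ 2) (hgood : W.HasGoodReductionAtPrime ℓ) (hΔ : IsSquare W.Δ) :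
    Odd (W.frobeniusTrace ℓ) ∨ (4 : ℤ) ∣ (ℓ : ℤ) + 1 - W.frobeniusTrace ℓ := by
  refine frobeniusTrace_of_isSquare_discr W ℓ hℓ hgood ?_
  have hZ : IsSquare (minimalDiscriminantInt W) := by
    rw [← Rat.isSquare_intCast_iff, cast_minimalDiscriminantInt]; exact hΔ
  obtain ⟨r, hr⟩ := hZ
  exact ⟨(r : ZMod ℓ), by rw [hr]; push_cast; ring⟩

/-- **Global square, newform form**: for `Δ_W ∈ ℚ×²`, any newform `f` of `W` and every odd good prime `ℓ`: `a_ℓ(f)` is odd, or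
`a_ℓ(f) = ℓ + 1 + 4j` for some `j ∈ ℤ`. [cite: SilvermanAEC2009, V.2.3.1 and Exercise 8.19(a)] -/
theorem cuspCoeff_of_isSquare_Δ {N : ℕ} [NeZero N] {f : CuspForm (CongruenceSubgroup.Gamma0 N) 2}
    (hf : ModularForms.IsNewformOf W f) (hℓ : ℓ ≠ 2) (hgood : W.HasGoodReductionAtPrime ℓ) (hΔ : IsSquare W.Δ) :
    (∃ a : ℤ, Odd a ∧ ModularForms.cuspCoeff f ℓ = (a : ℂ)) ∨
      ∃ j : ℤ, ModularForms.cuspCoeff f ℓ = (((ℓ : ℤ) + 1 + 4 * j : ℤ) : ℂ) := by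
  rw [hf.2 ℓ, W.LFunction_apply_prime_eq_frobeniusTrace ℓ hgood]
  rcases frobeniusTrace_of_isSquare_Δ W ℓ hℓ hgood hΔ with hodd | ⟨k, hk⟩
  · exact Or.inl ⟨_, hodd, rfl⟩
  · refine Or.inr ⟨-k, ?_⟩
    congr 1
    linear_combination -hk

end Rat

end Summit.BirchSwinnertonDyer.BirchSwinnertonDyer.Theorems.TwoAdicTwistConverse

end
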